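import Summits.Ventures.PercRepro.C025ProfileGirthPredCount
import Summits.Ventures.PercRepro.C025ProfileGirthHallSuccD
import Summits.Ventures.PercRepro.C025ProfileGirthEveryQ

/-!
# THE ROWS `(q, u)` AT GIRTH `≥ u − 1` — PART B: THE ROW, ITS HALL FORM, AND C-025 AT GIRTH `≥ p − 2` (night-3 g19)

With the double count of part A (`card_le_card_of_girth_pred_family`) in place of g18's injection, g18's proof of the
rows at girth `≥ u` goes through one step lower.  Write `u = v + 2`: every set of at most `v` points independent
(girth `≥ u − 1`), `q + 1 ≤ v` (`q ≤ u − 3`, so the rank-`q` sets are `q`-subsets).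
* `card_upAt_le_card_shadowLevel_pred` — the Boolean upper shadow of a family at the level `v + 2` is at most the
  matroid shadow (`ρ(E) ≥ v + 3`);
* **`hallIneq_of_girth_pred_rank`** — the Hall form (C-033) at `(q, v + 2)` on matroids of rank `≥ v + 3`, and
  `hallIneq_of_girth_pred_of_ne` for every rank `≠ v + 2` (rank `< v + 2`: every price is `0`);
* **`profileIneq_of_girth_pred`** `(hg : ∀ T ⊆ M.E, T.encard ≤ v → M.Indep T) (hqv : q + 1 ≤ v) :
  Profile.ProfileIneq M q (v + 2)` — the row (C-032) at EVERY rank (rank `v + 2` is complementation);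
* **`rls_of_girth_pred`** `(p q) (hq : 2 ≤ q) (hpq : q + 4 ≤ p) (hg : ∀ T ⊆ M.E, T.encard + 3 ≤ p → M.Indep T) :
  ThmN.RLS M p q` and `rls_of_girth_pred_every` (every `q`) — **C-025 at `(p, q)`, `p ≥ q + 4`, on every finite
  matroid of girth `≥ p − 2`** (g18: girth `≥ p − 1`): the rows `u ≤ p − 2` at girth `≥ u` (g18), the row `u = p − 1`
  at girth `≥ u − 1` (here).
Not covered: the Hall form at rank exactly `v + 2`; the row `q = u − 2` at girth `u − 1` (the `(u−1)`-circuits are then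
rank-`q` sets, as in g18's §7).  No `def`, no `instance`, no notation.  Axioms: standard.
-/

open scoped Matroid

namespace PercRepro

open Set Finset ThmH Staged

namespace GirthRows

variable {α : Type} [DecidableEq α] {M : Matroid α} [M.Finite]

/-- **The Boolean shadow is at most the matroid shadow** at girth `≥ v + 1`, one level higher than g18: for a family
`𝒜` of subsets of the ground set and `ρ(E) ≥ v + 3`, `#(upAt E (v+2) 𝒜) ≤ #(shadowLevel M (v+2) 𝒜)`. -/
theorem card_upAt_le_card_shadowLevel_pred {v : ℕ} (hg : ∀ T ⊆ M.E, T.encard ≤ v → M.Indep T)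
    (hrank : ((v + 3 : ℕ) : ℕ∞) ≤ M.eRank) (𝒜 : Finset (Finset α)) :
    (Boolean.upAt (gr M) (v + 2) 𝒜).card ≤ (Shadow.shadowLevel M (v + 2) 𝒜).card := by
  apply card_le_card_of_girth_pred_family hg hrank
  · intro S hS
    rw [Boolean.mem_upAt] at hS
    exact Finset.mem_powersetCard.2 hS.1
  · intro S hS hSi
    rw [Boolean.mem_upAt] at hS
    rw [mem_shadowLevel, Profile.mem_levelSet]
    refine ⟨⟨hS.1.1, ?_⟩, hS.2⟩
    rw [hSi.eRk_eq_encard, Set.encard_coe_eq_coe_finsetCard, hS.1.2]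
  · intro S hS hSr y hyg hyc
    rw [Boolean.mem_upAt] at hS
    obtain ⟨B, hB, hBS⟩ := hS.2
    rw [mem_shadowLevel, Profile.mem_levelSet]
    refine ⟨⟨Finset.insert_subset hyg hS.1.1, ?_⟩, B, hB, hBS.trans (Finset.subset_insert y S)⟩
    rw [← Staged.coe_rkN, rkN_insert_of_notMem_closure hyg hyc, hSr]
  · intro S hS hSr y hyg hyc y' hy'g hy'c
    rw [Boolean.mem_upAt] at hS
    obtain ⟨B, hB, hBS⟩ := hS.2
    rw [mem_shadowLevel, Profile.mem_levelSet]
    refine ⟨⟨Finset.insert_subset hy'g (Finset.insert_subset hyg hS.1.1), ?_⟩, B, hB,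
      hBS.trans ((Finset.subset_insert y S).trans (Finset.subset_insert y' _))⟩
    rw [← Staged.coe_rkN, rkN_insert_of_notMem_closure hy'g hy'c, rkN_insert_of_notMem_closure hyg hyc, hSr]

/-- **THE HALL FORM `(H⁺_{q, v+2})` AT GIRTH `≥ v + 1` ON MATROIDS OF RANK `≥ v + 3`**: if every set of at most `v`
points is independent and `q + 1 ≤ v`, then for every family `𝒜` of rank-`q` sets,
`Σ_{B ∈ 𝒜} price(B) ≤ #(shadowLevel M (v+2) 𝒜)` — C-033 at `(q, v + 2)` (g18's `hallIneq_of_girth_succ` needs every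
set of at most `v + 1` points independent). -/
theorem hallIneq_of_girth_pred_rank {q v : ℕ} (hg : ∀ T ⊆ M.E, T.encard ≤ v → M.Indep T)
    (hrank : ((v + 3 : ℕ) : ℕ∞) ≤ M.eRank) (hqv : q + 1 ≤ v) : Profile.HallIneq M q (v + 2) := by
  intro 𝒜 h𝒜
  set n := (gr M).card with hn
  have hAq : 𝒜 ⊆ (gr M).powersetCard q := h𝒜.trans (Rq_subset_powersetCard hg (by omega))
  obtain ⟨k, hk⟩ : ∃ k, v + 2 = q + k := ⟨v + 2 - q, by omega⟩
  have hnmp := Boolean.card_mul_choose_le_card_upAt_mul_choose hAq k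
  rw [← hk] at hnmp
  by_cases hAe : 𝒜 = ∅
  · subst hAe
    simp only [Finset.sum_empty]
    exact Nat.cast_nonneg _
  · obtain ⟨B₀, hB₀⟩ := Finset.nonempty_iff_ne_empty.2 hAe
    have hqn : q ≤ n := by
      have h := Finset.mem_powersetCard.1 (hAq hB₀)
      rw [← h.2]; exact Finset.card_le_card h.1
    have hq : (0 : ℚ) < Nat.choose n q := by exact_mod_cast Nat.choose_pos hqn
    calc ∑ B ∈ 𝒜, Profile.price M q (v + 2) B
        ≤ ∑ _B ∈ 𝒜, (Nat.choose n (v + 2) : ℚ) / (Nat.choose n q : ℚ) := by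
          apply Finset.sum_le_sum
          intro B hB
          have hB' := Finset.mem_powersetCard.1 (hAq hB)
          exact price_le_of_card (by omega) hB'.1 hB'.2
      _ = (𝒜.card : ℚ) * ((Nat.choose n (v + 2) : ℚ) / (Nat.choose n q : ℚ)) := by
          rw [Finset.sum_const, nsmul_eq_mul]
      _ ≤ ((Boolean.upAt (gr M) (v + 2) 𝒜).card : ℚ) := by
          rw [← mul_div_assoc, div_le_iff₀ hq]
          exact_mod_cast hnmp
      _ ≤ ((Shadow.shadowLevel M (v + 2) 𝒜).card : ℚ) := by
          exact_mod_cast card_upAt_le_card_shadowLevel_pred hg hrank 𝒜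

/-- The Hall form `(H⁺_{q, v+2})` at girth `≥ v + 1`, `q + 1 ≤ v`, for every rank other than `v + 2`. -/
theorem hallIneq_of_girth_pred_of_ne {q v : ℕ} (hg : ∀ T ⊆ M.E, T.encard ≤ v → M.Indep T) (hqv : q + 1 ≤ v)
    (hne : M.eRank ≠ ((v + 2 : ℕ) : ℕ∞)) : Profile.HallIneq M q (v + 2) := by
  rcases lt_or_ge M.eRank ((v + 3 : ℕ) : ℕ∞) with hlt | hge
  · apply hallIneq_of_eRank_lt
    have hfin : M.eRank ≠ ⊤ := ne_top_of_lt hlt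
    rw [← ENat.coe_toNat hfin] at hlt hne ⊢
    have b : M.eRank.toNat < v + 3 := by exact_mod_cast hlt
    have c : M.eRank.toNat ≠ v + 2 := by
      intro h; apply hne; rw [h]
    exact_mod_cast (by omega : M.eRank.toNat < v + 2)
  · exact hallIneq_of_girth_pred_rank hg hge hqv

/-- **THE ROW `(q, v + 2)` OF THE PROFILE INEQUALITY AT GIRTH `≥ v + 1`, EVERY RANK**: if every set of at most `v`
points is independent and `q + 1 ≤ v`, then `Σ_{B : ρ(B) = q} price(B) ≤ #{S : ρ(S) = v + 2}` — C-032 at `(q, u)` with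
`u = v + 2` on every finite matroid of girth `≥ u − 1`, `q ≤ u − 3` (g18: girth `≥ u`). -/
theorem profileIneq_of_girth_pred {q v : ℕ} (hg : ∀ T ⊆ M.E, T.encard ≤ v → M.Indep T) (hqv : q + 1 ≤ v) :
    Profile.ProfileIneq M q (v + 2) := by
  by_cases hE : M.eRank = ((v + 2 : ℕ) : ℕ∞)
  · exact profileIneq_of_eRank_eq hE
  · exact profileIneq_of_hallIneq q (v + 2) (hallIneq_of_girth_pred_of_ne hg hqv hE)

/-- **C-025 AT `(p, q)` ON EVERY MATROID OF GIRTH `≥ p − 2`**, `p ≥ q + 4`, `q ≥ 2`: if every set with at most `p − 3`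
points is independent, then `ThmN.RLS M p q` — the rows `u ≤ p − 2` at girth `≥ u` (g18) and the row `u = p − 1` at
girth `≥ u − 1` (`profileIneq_of_girth_pred`), through the pointwise bridge. -/
theorem rls_of_girth_pred (p q : ℕ) (hq : 2 ≤ q) (hpq : q + 4 ≤ p)
    (hg : ∀ T ⊆ M.E, T.encard + 3 ≤ p → M.Indep T) : ThmN.RLS M p q := by
  apply rls_of_profileIneq_rows p q
  intro u hqu hup
  obtain ⟨w, rfl⟩ : ∃ w, u = w + 1 := ⟨u - 1, by omega⟩
  rcases Nat.lt_or_ge (w + 1) (p - 1) with hlt | hge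
  · -- `u ≤ p − 2`: girth `≥ u`, i.e. every set of at most `w` points independent
    have hg' : ∀ T ⊆ M.E, T.encard ≤ w → M.Indep T := by
      intro T hT hTw
      apply hg T hT
      have h1 : T.encard + 3 ≤ (w : ℕ∞) + 3 := by gcongr
      refine h1.trans ?_
      have h2 : ((w + 3 : ℕ) : ℕ∞) ≤ (p : ℕ∞) := by exact_mod_cast (by omega : w + 3 ≤ p)
      simpa using h2
    rcases Nat.lt_or_ge q w with hqw | hwq
    · exact profileIneq_of_girth_succ hg' hqw
    · have hqw' : q = w := by omega
      subst hqw'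
      exact profileIneq_succ_of_girth hq hg'
  · -- `u = p − 1`: girth `≥ u − 1`, i.e. every set of at most `p − 3` points independent
    have hw : w = p - 3 + 1 := by omega
    subst hw
    have hg'' : ∀ T ⊆ M.E, T.encard ≤ (p - 3 : ℕ) → M.Indep T := by
      intro T hT hTv
      apply hg T hT
      have h1 : T.encard + 3 ≤ ((p - 3 : ℕ) : ℕ∞) + 3 := by gcongr
      refine h1.trans ?_
      have h2 : ((p - 3 + 3 : ℕ) : ℕ∞) ≤ (p : ℕ∞) := by exact_mod_cast (by omega : p - 3 + 3 ≤ p)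
      simpa using h2
    exact profileIneq_of_girth_pred hg'' (by omega)

/-- C-025 at `(p, q)`, `p ≥ q + 4`, on every matroid of girth `≥ p − 2`, for EVERY `q` (the rows `q ≤ 1` hold on every
matroid, `rls_of_q_le_one`). -/
theorem rls_of_girth_pred_every (p q : ℕ) (hpq : q + 4 ≤ p)
    (hg : ∀ T ⊆ M.E, T.encard + 3 ≤ p → M.Indep T) : ThmN.RLS M p q := by
  rcases Nat.lt_or_ge q 2 with hq | hq
  · exact rls_of_q_le_one p q (by omega) (by omega)
  · exact rls_of_girth_pred p q hq hpq hg

end GirthRows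

end PercRepro
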